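/-
Copyright: the b2b-balaban T⁴-continuum CRUX team, row NE7b leaf lineage `t4-ne7b-formalise-leaf-06` (gen 147). Project licence.
-/
import Literature.Probability.Moments.BrascampLiebVarianceViaPrekopaLeindler
import Summits.QuantumFields.BalabanUV.T4Continuum.Spine.NE7b.ConvexTiltMoment

/-!
# THE WINDOW-MASS LETTER FOR SLAB (PER-BOND) WINDOWS, LOGARITHMIC IN THE NUMBER OF CONSTRAINTS: Maurey's half-space
# deviation inequality from Prékopa–Leindler under `λ`-uniform convexity — no upper pinch, no critical point
# (row NE7b, node U5c; the `hmass` letter of `…ConvexTiltMoment.exp_moment_le_of_uniformlyConvex_window`; kernel lemmas of real analysis)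

Cell `pub-balaban`, sub-cell `t4`, spine estimate NE7b (`T4WeightBudget.RelWeightBound`; the cell's OWN estimate — NOT PRINTED in
[Bałaban 1983–89], NOT PROVED).  Crux-route work under `Spine/NE7b/` by a row leaf on the convexity road; NOTHING of Bałaban's is named
or asserted; no `T4Continuum/Support` leaf typed; no `def`; zero `sorry`.

WHY.  `…ConvexTiltMoment` §4 (the convexity road ON A WINDOW `K`) displays `hmass : (1−η)·∫e^{−V} ≤ ∫_K e^{−V}`.  The OWNER's
`…ConvexWindowMass` supplies it for a Euclidean BALL in the two-sided pinch model, with `η = e^{−λR²∕4}(2Λ∕λ)^{d∕2}` — usable iff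
`R² > (2d∕λ)·log(2Λ∕λ)`, a radius growing like `√d` (`d` = number of real variables).  Print's windows are PRODUCTS of per-bond
constraints `|⟪u_i, y⟫ − c_i| < ρ`; such a window contains only the Euclidean `ρ`-ball.  THIS FILE supplies the `hmass` letter for the
slab∕product window ITSELF, with `η = 2·|ι|·e^{−λρ²∕4}∕θ` — LOGARITHMIC in the number `|ι|` of constraints (`η < 1` iff
`ρ² > (4∕λ)·log(2|ι|∕θ)`), with NO upper pinch `Λ` and NO critical point: only the road's own first-order `λ`-convexity letter, the
normalisation `‖u_i‖ ≤ 1`, and, DISPLAYED, centres `c_i` whose two closed half-spaces each carry at least the fraction `θ` of the mass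
(`θ = ½` at the tilted medians, which always exist — not constructed here; `θ = ½` exactly under central symmetry — §3).

WHAT IS PROVED ([folklore]; B. Maurey's Prékopa–Leindler argument for Gaussian-type deviation under uniform convexity, run on the
tree's PROVED `Literature.Analysis.Convexity.prekopaLeindler_integral` and `Literature.Probability.Moments.midpoint_le_of_uniformlyConvex`):
§1 **`halfSpaceMass_mul_tailMass_le`** — for `‖u‖ ≤ 1`, `t ≥ 0`, any level `a`:
`(∫_{⟪u,x⟫ ≤ a} e^{−V})·(∫_{a+t ≤ ⟪u,y⟫} e^{−V}) ≤ e^{−λt²∕4}·(∫e^{−V})²` (Prékopa–Leindler at `s = ½` with `f = 𝟙_{⟪u,·⟫≤a}e^{−V}`,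
`g = 𝟙_{⟪u,·⟫≥a+t}e^{λt²∕4}e^{−V}`, `h = e^{−V}`: on the supports `‖x−y‖ ≥ ⟪u,y−x⟫ ≥ t`, and midpoint `λ`-convexity pays `λt²∕8`).
§2 **`tailMass_le_of_halfSpaceMass`** (one-sided tail `≤ e^{−λρ²∕4}·Z∕θ` when the opposite closed half-space carries `≥ θZ`) and
**`slabWindowMass_ge`** — the `hmass` letter for `K = {y | ∀ i, |⟪u_i,y⟫ − c_i| < ρ}`:
`(1 − 2|ι|e^{−λρ²∕4}∕θ)·∫e^{−V} ≤ ∫_K e^{−V}`.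
§3 **`halfSpaceMass_ge_half_of_symmetric`** (central symmetry `V(x₀ + v) = V(x₀ − v)` ⇒ every closed half-space through `x₀` carries
`≥ ½∫e^{−V}`) and **`slabWindowMass_ge_of_symmetric`** (`η = 4|ι|e^{−λρ²∕4}`, centres `c_i = ⟪u_i, x₀⟫`).
§4 **`exp_moment_le_of_uniformlyConvex_slabWindow`** — the OWNER's window END BY NAME with `K :=` the slab window and `hmass`
SUPPLIED by §2; displayed: `θ`, the two half-space masses per constraint, and `hη : 2|ι|e^{−λρ²∕4}∕θ < 1`.

NOT HERE (honest): the existence of tilted medians (`θ = ½` in general); the identification of print's small-field windows, centres and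
per-bond functionals ((A1c) readings); anything of Bałaban's.  NE7b NOT PRINTED ∕ NOT PROVED; spine PROVED 0∕9; rung (B)+1 on a FINITE
torus — NOT infinite volume, NOT the mass gap, NOT Clay.
HONEST DEPENDENCY: continuum YM on T⁴ ⇐ BetaPertH ∧ nine spine estimates (0/9 proved); BetaPertH ⇐ (D1) ∧ (D4) ∧ CAP+tail.
-/

set_option autoImplicit false

noncomputable section

open MeasureTheory Real
open scoped RealInnerProductSpace

namespace Summit.QuantumFields.BalabanUV.T4Continuum.NE7b.ConvexSlabWindowMass

variable {n : ℕ}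

/-! ## §1 Maurey's half-space deviation inequality from Prékopa–Leindler -/

/-- **HALF-SPACE MASS × TAIL MASS** (Maurey's Prékopa–Leindler argument): for `V` `λ`-uniformly convex (first-order letter), `e^{−V}`
integrable, `‖u‖ ≤ 1`, `0 ≤ t` and any level `a`,
`(∫_{⟪u,x⟫ ≤ a} e^{−V})·(∫_{a + t ≤ ⟪u,y⟫} e^{−V}) ≤ e^{−λt²∕4}·(∫ e^{−V})²`. [folklore] -/
theorem halfSpaceMass_mul_tailMass_le {V : EuclideanSpace ℝ (Fin n) → ℝ} {lam : ℝ} (hlam : 0 < lam)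
    (hVc : Continuous V)
    (hV : ∀ x y : EuclideanSpace ℝ (Fin n), V x + ⟪gradient V x, y - x⟫ + lam / 2 * ‖y - x‖ ^ 2 ≤ V y)
    (hZ : Integrable fun x => exp (-V x)) {u : EuclideanSpace ℝ (Fin n)} (hu : ‖u‖ ≤ 1) (a : ℝ) {t : ℝ}
    (ht : 0 ≤ t) :
    (∫ x in {x | ⟪u, x⟫ ≤ a}, exp (-V x)) * (∫ y in {y | a + t ≤ ⟪u, y⟫}, exp (-V y)) ≤
      exp (-(lam * t ^ 2 / 4)) * (∫ z, exp (-V z)) ^ 2 := by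
  set A : Set (EuclideanSpace ℝ (Fin n)) := {x | ⟪u, x⟫ ≤ a} with hA
  set B : Set (EuclideanSpace ℝ (Fin n)) := {y | a + t ≤ ⟪u, y⟫} with hB
  have hum : Measurable fun x : EuclideanSpace ℝ (Fin n) => ⟪u, x⟫ :=
    (continuous_const.inner continuous_id).measurable
  have hAm : MeasurableSet A := measurableSet_le hum measurable_const
  have hBm : MeasurableSet B := measurableSet_le measurable_const hum
  have hem : Measurable fun x : EuclideanSpace ℝ (Fin n) => exp (-V x) :=
    (continuous_exp.comp hVc.neg).measurable
  set c : ℝ := lam * t ^ 2 / 4 with hc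
  -- the three Prékopa–Leindler functions: `f = 𝟙_A e^{−V}`, `g = 𝟙_B e^{c} e^{−V}`, `h = e^{−V}`
  have hf0 : ∀ x, 0 ≤ A.indicator (fun x => exp (-V x)) x :=
    fun x => Set.indicator_nonneg (fun _ _ => (exp_pos _).le) _
  have hg0 : ∀ y, 0 ≤ B.indicator (fun y => exp c * exp (-V y)) y :=
    fun y => Set.indicator_nonneg (fun _ _ => mul_nonneg (exp_pos _).le (exp_pos _).le) _
  have key := Literature.Analysis.Convexity.prekopaLeindler_integral (n := n) (s := 1 / 2)
    (by norm_num) (by norm_num) (hem.indicator hAm) ((hem.const_mul _).indicator hBm) hem hf0 hg0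
    (fun _ => (exp_pos _).le) (hZ.indicator hAm) ((hZ.const_mul _).indicator hBm) hZ ?_
  · -- square and evaluate the three integrals
    have hIf : ∫ x, A.indicator (fun x => exp (-V x)) x = ∫ x in A, exp (-V x) := integral_indicator hAm
    have hIg : ∫ y, B.indicator (fun y => exp c * exp (-V y)) y = exp c * ∫ y in B, exp (-V y) := by
      rw [integral_indicator hBm, integral_const_mul]
    rw [hIf, hIg] at key
    norm_num at key
    have h0A : 0 ≤ ∫ x in A, exp (-V x) := integral_nonneg fun _ => (exp_pos _).le
    have h0B : 0 ≤ ∫ y in B, exp (-V y) := integral_nonneg fun _ => (exp_pos _).le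
    have h0Z : 0 ≤ ∫ z, exp (-V z) := integral_nonneg fun _ => (exp_pos _).le
    have h0cB : 0 ≤ exp c * ∫ y in B, exp (-V y) := mul_nonneg (exp_pos _).le h0B
    have hsq : ((∫ x in A, exp (-V x)) ^ (1 / 2 : ℝ) * (exp c * ∫ y in B, exp (-V y)) ^ (1 / 2 : ℝ)) ^ 2 =
        (∫ x in A, exp (-V x)) * (exp c * ∫ y in B, exp (-V y)) := by
      rw [mul_pow, ← rpow_natCast, ← rpow_natCast, ← rpow_mul h0A, ← rpow_mul h0cB]
      norm_num
    have hprod : (∫ x in A, exp (-V x)) * (exp c * ∫ y in B, exp (-V y)) ≤ (∫ z, exp (-V z)) ^ 2 := by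
      rw [← hsq]
      exact pow_le_pow_left₀ (by positivity) key 2
    calc (∫ x in A, exp (-V x)) * (∫ y in B, exp (-V y))
        = exp (-c) * ((∫ x in A, exp (-V x)) * (exp c * ∫ y in B, exp (-V y))) := by
          rw [Real.exp_neg]
          field_simp
      _ ≤ exp (-c) * (∫ z, exp (-V z)) ^ 2 := mul_le_mul_of_nonneg_left hprod (exp_pos _).le
  · -- the pointwise Prékopa–Leindler hypothesis
    intro x y
    norm_num
    by_cases hx : x ∈ A
    · by_cases hy : y ∈ B
      · rw [Set.indicator_of_mem hx, Set.indicator_of_mem hy, ← exp_add, ← exp_mul, ← exp_mul, ← exp_add]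
        refine exp_le_exp.2 ?_
        have hmid := Literature.Probability.Moments.midpoint_le_of_uniformlyConvex hV x y
        -- on the supports: `t ≤ ⟪u, y − x⟫ ≤ ‖y − x‖`
        have hxa : ⟪u, x⟫ ≤ a := hx
        have hyb : a + t ≤ ⟪u, y⟫ := hy
        have hinner : ⟪u, y - x⟫ ≤ ‖x - y‖ := by
          calc ⟪u, y - x⟫ ≤ ‖u‖ * ‖y - x‖ := real_inner_le_norm _ _
            _ ≤ 1 * ‖y - x‖ := mul_le_mul_of_nonneg_right hu (norm_nonneg _)
            _ = ‖x - y‖ := by rw [one_mul, norm_sub_rev]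
        have htd : t ≤ ‖x - y‖ := by rw [inner_sub_right] at hinner; linarith
        have hsq : t ^ 2 ≤ ‖x - y‖ ^ 2 := pow_le_pow_left₀ ht htd 2
        have hlt : lam / 8 * t ^ 2 ≤ lam / 8 * ‖x - y‖ ^ 2 := mul_le_mul_of_nonneg_left hsq (by positivity)
        rw [hc]
        linarith
      · rw [Set.indicator_of_notMem hy, zero_rpow (by norm_num), mul_zero]
        exact (exp_pos _).le
    · rw [Set.indicator_of_notMem hx, zero_rpow (by norm_num), zero_mul]
      exact (exp_pos _).le

/-! ## §2 One-sided tails and the slab-window mass -/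

/-- **ONE-SIDED TAIL FROM THE OPPOSITE HALF-SPACE MASS**: if the closed half-space `{⟪u,x⟫ ≤ a}` carries at least `θ·∫e^{−V}`
(`θ > 0`), then `∫_{a + ρ ≤ ⟪u,y⟫} e^{−V} ≤ e^{−λρ²∕4}·(∫e^{−V})∕θ`. [folklore] -/
theorem tailMass_le_of_halfSpaceMass {V : EuclideanSpace ℝ (Fin n) → ℝ} {lam : ℝ} (hlam : 0 < lam)
    (hVc : Continuous V)
    (hV : ∀ x y : EuclideanSpace ℝ (Fin n), V x + ⟪gradient V x, y - x⟫ + lam / 2 * ‖y - x‖ ^ 2 ≤ V y)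
    (hZ : Integrable fun x => exp (-V x)) {u : EuclideanSpace ℝ (Fin n)} (hu : ‖u‖ ≤ 1) (a : ℝ) {ρ θ : ℝ}
    (hρ : 0 ≤ ρ) (hθ : 0 < θ) (hlo : θ * ∫ z, exp (-V z) ≤ ∫ x in {x | ⟪u, x⟫ ≤ a}, exp (-V x)) :
    ∫ y in {y | a + ρ ≤ ⟪u, y⟫}, exp (-V y) ≤ exp (-(lam * ρ ^ 2 / 4)) * (∫ z, exp (-V z)) / θ := by
  have h1 := halfSpaceMass_mul_tailMass_le hlam hVc hV hZ hu a hρ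
  have hZpos : 0 < ∫ z, exp (-V z) := integral_exp_pos hZ
  have hT0 : 0 ≤ ∫ y in {y | a + ρ ≤ ⟪u, y⟫}, exp (-V y) := integral_nonneg fun _ => (exp_pos _).le
  have h2 : θ * (∫ y in {y | a + ρ ≤ ⟪u, y⟫}, exp (-V y)) * (∫ z, exp (-V z)) ≤
      exp (-(lam * ρ ^ 2 / 4)) * (∫ z, exp (-V z)) * (∫ z, exp (-V z)) := by
    calc θ * (∫ y in {y | a + ρ ≤ ⟪u, y⟫}, exp (-V y)) * (∫ z, exp (-V z))
        = (θ * ∫ z, exp (-V z)) * (∫ y in {y | a + ρ ≤ ⟪u, y⟫}, exp (-V y)) := by ring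
      _ ≤ (∫ x in {x | ⟪u, x⟫ ≤ a}, exp (-V x)) * (∫ y in {y | a + ρ ≤ ⟪u, y⟫}, exp (-V y)) :=
          mul_le_mul_of_nonneg_right hlo hT0
      _ ≤ exp (-(lam * ρ ^ 2 / 4)) * (∫ z, exp (-V z)) ^ 2 := h1
      _ = exp (-(lam * ρ ^ 2 / 4)) * (∫ z, exp (-V z)) * (∫ z, exp (-V z)) := by ring
  have h3 : θ * (∫ y in {y | a + ρ ≤ ⟪u, y⟫}, exp (-V y)) ≤ exp (-(lam * ρ ^ 2 / 4)) * (∫ z, exp (-V z)) :=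
    le_of_mul_le_mul_right h2 hZpos
  rw [le_div_iff₀ hθ]
  linarith

/-- **LOWER TAIL**, the mirror image of `tailMass_le_of_halfSpaceMass` (apply it to `−u`, `−a`): if `{a ≤ ⟪u,x⟫}` carries at least
`θ·∫e^{−V}`, then `∫_{⟪u,y⟫ ≤ a − ρ} e^{−V} ≤ e^{−λρ²∕4}·(∫e^{−V})∕θ`. [folklore] -/
theorem lowerTailMass_le_of_halfSpaceMass {V : EuclideanSpace ℝ (Fin n) → ℝ} {lam : ℝ} (hlam : 0 < lam)
    (hVc : Continuous V)
    (hV : ∀ x y : EuclideanSpace ℝ (Fin n), V x + ⟪gradient V x, y - x⟫ + lam / 2 * ‖y - x‖ ^ 2 ≤ V y)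
    (hZ : Integrable fun x => exp (-V x)) {u : EuclideanSpace ℝ (Fin n)} (hu : ‖u‖ ≤ 1) (a : ℝ) {ρ θ : ℝ}
    (hρ : 0 ≤ ρ) (hθ : 0 < θ) (hhi : θ * ∫ z, exp (-V z) ≤ ∫ x in {x | a ≤ ⟪u, x⟫}, exp (-V x)) :
    ∫ y in {y | ⟪u, y⟫ ≤ a - ρ}, exp (-V y) ≤ exp (-(lam * ρ ^ 2 / 4)) * (∫ z, exp (-V z)) / θ := by
  have hu' : ‖-u‖ ≤ 1 := by rwa [norm_neg]
  have hA : {x : EuclideanSpace ℝ (Fin n) | ⟪-u, x⟫ ≤ -a} = {x | a ≤ ⟪u, x⟫} := by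
    ext x; simp only [Set.mem_setOf_eq, inner_neg_left, neg_le_neg_iff]
  have hB : {y : EuclideanSpace ℝ (Fin n) | -a + ρ ≤ ⟪-u, y⟫} = {y | ⟪u, y⟫ ≤ a - ρ} := by
    ext y; simp only [Set.mem_setOf_eq, inner_neg_left]; constructor <;> intro h <;> linarith
  have h := tailMass_le_of_halfSpaceMass hlam hVc hV hZ hu' (-a) hρ hθ (by rwa [hA])
  rwa [hB] at h

/-- **THE SLAB WINDOW CARRIES ALL BUT THE FRACTION `η = 2|ι|e^{−λρ²∕4}∕θ`** (the `hmass` letter of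
`…ConvexTiltMoment.exp_moment_le_of_uniformlyConvex_window` with `K = {y | ∀ i, |⟪u_i,y⟫ − c_i| < ρ}`): for `V` `λ`-uniformly
convex with `e^{−V}` integrable, functionals `‖u_i‖ ≤ 1`, half-width `ρ ≥ 0`, and centres `c_i` such that BOTH closed half-spaces
`{⟪u_i,x⟫ ≤ c_i}`, `{c_i ≤ ⟪u_i,x⟫}` carry at least `θ·∫e^{−V}` (`θ > 0`; `θ = ½` at medians),
`(1 − 2|ι|e^{−λρ²∕4}∕θ)·∫e^{−V} ≤ ∫_K e^{−V}`. [folklore] -/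
theorem slabWindowMass_ge {ι : Type*} [Fintype ι] {V : EuclideanSpace ℝ (Fin n) → ℝ} {lam : ℝ} (hlam : 0 < lam)
    (hVc : Continuous V)
    (hV : ∀ x y : EuclideanSpace ℝ (Fin n), V x + ⟪gradient V x, y - x⟫ + lam / 2 * ‖y - x‖ ^ 2 ≤ V y)
    (hZ : Integrable fun x => exp (-V x)) (u : ι → EuclideanSpace ℝ (Fin n)) (hu : ∀ i, ‖u i‖ ≤ 1)
    (c : ι → ℝ) {ρ θ : ℝ} (hρ : 0 ≤ ρ) (hθ : 0 < θ)
    (hlo : ∀ i, θ * ∫ z, exp (-V z) ≤ ∫ x in {x | ⟪u i, x⟫ ≤ c i}, exp (-V x))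
    (hhi : ∀ i, θ * ∫ z, exp (-V z) ≤ ∫ x in {x | c i ≤ ⟪u i, x⟫}, exp (-V x)) :
    (1 - 2 * Fintype.card ι * exp (-(lam * ρ ^ 2 / 4)) / θ) * ∫ z, exp (-V z) ≤
      ∫ x in {x | ∀ i, |⟪u i, x⟫ - c i| < ρ}, exp (-V x) := by
  classical
  set Z : ℝ := ∫ z, exp (-V z) with hZdef
  set ε : ℝ := exp (-(lam * ρ ^ 2 / 4)) with hε
  set K : Set (EuclideanSpace ℝ (Fin n)) := {x | ∀ i, |⟪u i, x⟫ - c i| < ρ} with hK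
  -- the one-sided tail sets
  set U : ι → Set (EuclideanSpace ℝ (Fin n)) := fun i => {x | c i + ρ ≤ ⟪u i, x⟫} with hU
  set L : ι → Set (EuclideanSpace ℝ (Fin n)) := fun i => {x | ⟪u i, x⟫ ≤ c i - ρ} with hL
  have hum : ∀ i, Measurable fun x : EuclideanSpace ℝ (Fin n) => ⟪u i, x⟫ :=
    fun i => (continuous_const.inner continuous_id).measurable
  have hUm : ∀ i, MeasurableSet (U i) := fun i => measurableSet_le measurable_const (hum i)
  have hLm : ∀ i, MeasurableSet (L i) := fun i => measurableSet_le (hum i) measurable_const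
  have hKeq : K = ⋂ i, {x | |⟪u i, x⟫ - c i| < ρ} := by ext x; simp [hK]
  have hKm : MeasurableSet K := by
    rw [hKeq]
    exact MeasurableSet.iInter fun i =>
      measurableSet_lt (continuous_abs.measurable.comp ((hum i).sub measurable_const)) measurable_const
  -- each tail is at most `ε Z ∕ θ`
  have hUle : ∀ i, ∫ x in U i, exp (-V x) ≤ ε * Z / θ :=
    fun i => tailMass_le_of_halfSpaceMass hlam hVc hV hZ (hu i) (c i) hρ hθ (hlo i)
  have hLle : ∀ i, ∫ x in L i, exp (-V x) ≤ ε * Z / θ :=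
    fun i => lowerTailMass_le_of_halfSpaceMass hlam hVc hV hZ (hu i) (c i) hρ hθ (hhi i)
  -- the complement of the window is covered by the tails
  have hnn : ∀ (s : Set (EuclideanSpace ℝ (Fin n))) (x : EuclideanSpace ℝ (Fin n)),
      0 ≤ s.indicator (fun x => exp (-V x)) x :=
    fun s x => Set.indicator_nonneg (fun _ _ => (exp_pos _).le) _
  have hcover : ∀ x, Kᶜ.indicator (fun x => exp (-V x)) x ≤
      ∑ i, ((U i).indicator (fun x => exp (-V x)) x + (L i).indicator (fun x => exp (-V x)) x) := by
    intro x
    by_cases hx : x ∈ Kᶜ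
    · obtain ⟨i, hi⟩ : ∃ i, ρ ≤ |⟪u i, x⟫ - c i| := by
        simpa [hK, not_lt] using hx
      rw [Set.indicator_of_mem hx]
      refine le_trans ?_ (Finset.single_le_sum (fun j _ => add_nonneg (hnn _ _) (hnn _ _)) (Finset.mem_univ i))
      rcases le_abs'.1 hi with h | h
      · have hxL : x ∈ L i := by show ⟪u i, x⟫ ≤ c i - ρ; linarith
        rw [Set.indicator_of_mem hxL]
        linarith [hnn (U i) x]
      · have hxU : x ∈ U i := by show c i + ρ ≤ ⟪u i, x⟫; linarith
        rw [Set.indicator_of_mem hxU]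
        linarith [hnn (L i) x]
    · rw [Set.indicator_of_notMem hx]
      exact Finset.sum_nonneg fun j _ => add_nonneg (hnn _ _) (hnn _ _)
  have hcompl : ∫ x in Kᶜ, exp (-V x) ≤ ∑ i, ((∫ x in U i, exp (-V x)) + ∫ x in L i, exp (-V x)) := by
    have hint : ∀ i, Integrable (fun x => (U i).indicator (fun x => exp (-V x)) x +
        (L i).indicator (fun x => exp (-V x)) x) := fun i => (hZ.indicator (hUm i)).add (hZ.indicator (hLm i))
    calc ∫ x in Kᶜ, exp (-V x) = ∫ x, Kᶜ.indicator (fun x => exp (-V x)) x := (integral_indicator hKm.compl).symm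
      _ ≤ ∫ x, ∑ i, ((U i).indicator (fun x => exp (-V x)) x + (L i).indicator (fun x => exp (-V x)) x) :=
          integral_mono (hZ.indicator hKm.compl) (integrable_finsetSum _ fun i _ => hint i) hcover
      _ = ∑ i, ((∫ x in U i, exp (-V x)) + ∫ x in L i, exp (-V x)) := by
          rw [integral_finsetSum _ fun i _ => hint i]
          refine Finset.sum_congr rfl fun i _ => ?_
          rw [integral_add (hZ.indicator (hUm i)) (hZ.indicator (hLm i)), integral_indicator (hUm i),
            integral_indicator (hLm i)]
  have hsum : ∑ i, ((∫ x in U i, exp (-V x)) + ∫ x in L i, exp (-V x)) ≤ Fintype.card ι * (2 * (ε * Z / θ)) := by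
    calc ∑ i, ((∫ x in U i, exp (-V x)) + ∫ x in L i, exp (-V x)) ≤ ∑ _i : ι, 2 * (ε * Z / θ) :=
          Finset.sum_le_sum fun i _ => by linarith [hUle i, hLle i]
      _ = Fintype.card ι * (2 * (ε * Z / θ)) := by rw [Finset.sum_const, Finset.card_univ, nsmul_eq_mul]
  have hsplit := integral_add_compl hKm hZ
  have hKval : ∫ x in K, exp (-V x) = Z - ∫ x in Kᶜ, exp (-V x) := by rw [hZdef]; linarith [hsplit]
  rw [hKval]
  have halg : (1 - 2 * Fintype.card ι * ε / θ) * Z = Z - Fintype.card ι * (2 * (ε * Z / θ)) := by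
    field_simp
  rw [halg]
  linarith [hcompl, hsum]

/-! ## §3 The symmetric case: every closed half-space through the centre carries half the mass -/

/-- **HALF-SPACES THROUGH A CENTRE OF SYMMETRY CARRY HALF THE MASS**: if `V (x₀ + v) = V (x₀ − v)` for all `v` and `e^{−V}` is
integrable, then for every `u`, `½·∫e^{−V} ≤ ∫_{⟪u,x⟫ ≤ ⟪u,x₀⟫} e^{−V}` (the reflection `x ↦ 2x₀ − x` preserves Lebesgue measure,
exchanges the two closed half-spaces, and they cover the space). [folklore] -/
theorem halfSpaceMass_ge_half_of_symmetric {V : EuclideanSpace ℝ (Fin n) → ℝ}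
    (x₀ : EuclideanSpace ℝ (Fin n)) (hsymm : ∀ v, V (x₀ + v) = V (x₀ - v))
    (hZ : Integrable fun x => exp (-V x)) (u : EuclideanSpace ℝ (Fin n)) :
    1 / 2 * ∫ z, exp (-V z) ≤ ∫ x in {x | ⟪u, x⟫ ≤ ⟪u, x₀⟫}, exp (-V x) := by
  set A : Set (EuclideanSpace ℝ (Fin n)) := {x | ⟪u, x⟫ ≤ ⟪u, x₀⟫} with hA
  set A' : Set (EuclideanSpace ℝ (Fin n)) := {x | ⟪u, x₀⟫ ≤ ⟪u, x⟫} with hA'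
  have hum : Measurable fun x : EuclideanSpace ℝ (Fin n) => ⟪u, x⟫ :=
    (continuous_const.inner continuous_id).measurable
  have hAm : MeasurableSet A := measurableSet_le hum measurable_const
  have hA'm : MeasurableSet A' := measurableSet_le measurable_const hum
  -- the reflection `x ↦ (x₀ + x₀) − x` carries `A'` onto `A` and fixes `e^{−V}`
  have hrefl : ∫ x in A', exp (-V x) = ∫ x in A, exp (-V x) := by
    rw [← integral_indicator hA'm, ← integral_indicator hAm,
      ← integral_sub_left_eq_self (fun x => A.indicator (fun x => exp (-V x)) x) volume (x₀ + x₀)]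
    refine integral_congr_ae (ae_of_all _ fun x => ?_)
    show A'.indicator (fun x => exp (-V x)) x = A.indicator (fun x => exp (-V x)) (x₀ + x₀ - x)
    have hVx : V (x₀ + x₀ - x) = V x := by
      have := hsymm (x₀ - x)
      rwa [add_sub, sub_sub_cancel] at this
    have hmem : (x₀ + x₀ - x ∈ A) ↔ (x ∈ A') := by
      simp only [hA, hA', Set.mem_setOf_eq, inner_sub_right, inner_add_right]
      constructor <;> intro h <;> linarith
    by_cases hx : x ∈ A'
    · rw [Set.indicator_of_mem hx, Set.indicator_of_mem (hmem.2 hx), hVx]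
    · rw [Set.indicator_of_notMem hx, Set.indicator_of_notMem (fun h => hx (hmem.1 h))]
  -- the two closed half-spaces cover the space
  have hcover : ∫ z, exp (-V z) ≤ (∫ x in A, exp (-V x)) + ∫ x in A', exp (-V x) := by
    rw [← integral_indicator hAm, ← integral_indicator hA'm, ← integral_add (hZ.indicator hAm) (hZ.indicator hA'm)]
    refine integral_mono hZ ((hZ.indicator hAm).add (hZ.indicator hA'm)) fun x => ?_
    have hnnA : 0 ≤ A.indicator (fun x => exp (-V x)) x := Set.indicator_nonneg (fun _ _ => (exp_pos _).le) _
    have hnnA' : 0 ≤ A'.indicator (fun x => exp (-V x)) x := Set.indicator_nonneg (fun _ _ => (exp_pos _).le) _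
    rcases le_total ⟪u, x⟫ ⟪u, x₀⟫ with h | h
    · have hx : x ∈ A := h
      simp only [Set.indicator_of_mem hx]
      linarith
    · have hx : x ∈ A' := h
      simp only [Set.indicator_of_mem hx]
      linarith
  rw [hrefl] at hcover
  linarith

/-- **THE SLAB WINDOW ABOUT A CENTRE OF SYMMETRY**: under central symmetry of `V` about `x₀`, the window
`K = {y | ∀ i, |⟪u_i, y − x₀⟫| < ρ}` carries all but the fraction `η = 4|ι|e^{−λρ²∕4}` of the mass (`θ = ½` supplied by
`halfSpaceMass_ge_half_of_symmetric`). [folklore] -/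
theorem slabWindowMass_ge_of_symmetric {ι : Type*} [Fintype ι] {V : EuclideanSpace ℝ (Fin n) → ℝ} {lam : ℝ}
    (hlam : 0 < lam) (hVc : Continuous V)
    (hV : ∀ x y : EuclideanSpace ℝ (Fin n), V x + ⟪gradient V x, y - x⟫ + lam / 2 * ‖y - x‖ ^ 2 ≤ V y)
    (hZ : Integrable fun x => exp (-V x)) (x₀ : EuclideanSpace ℝ (Fin n)) (hsymm : ∀ v, V (x₀ + v) = V (x₀ - v))
    (u : ι → EuclideanSpace ℝ (Fin n)) (hu : ∀ i, ‖u i‖ ≤ 1) {ρ : ℝ} (hρ : 0 ≤ ρ) :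
    (1 - 4 * Fintype.card ι * exp (-(lam * ρ ^ 2 / 4))) * ∫ z, exp (-V z) ≤
      ∫ x in {x | ∀ i, |⟪u i, x - x₀⟫| < ρ}, exp (-V x) := by
  have hlo : ∀ i, 1 / 2 * ∫ z, exp (-V z) ≤ ∫ x in {x | ⟪u i, x⟫ ≤ ⟪u i, x₀⟫}, exp (-V x) :=
    fun i => halfSpaceMass_ge_half_of_symmetric x₀ hsymm hZ (u i)
  have hhi : ∀ i, 1 / 2 * ∫ z, exp (-V z) ≤ ∫ x in {x | ⟪u i, x₀⟫ ≤ ⟪u i, x⟫}, exp (-V x) := by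
    intro i
    have h := halfSpaceMass_ge_half_of_symmetric x₀ hsymm hZ (-u i)
    have hA : {x : EuclideanSpace ℝ (Fin n) | ⟪-u i, x⟫ ≤ ⟪-u i, x₀⟫} = {x | ⟪u i, x₀⟫ ≤ ⟪u i, x⟫} := by
      ext x; simp only [Set.mem_setOf_eq, inner_neg_left, neg_le_neg_iff]
    rwa [hA] at h
  have h := slabWindowMass_ge hlam hVc hV hZ u hu (fun i => ⟪u i, x₀⟫) hρ (by norm_num : (0 : ℝ) < 1 / 2) hlo hhi
  have hK : {x : EuclideanSpace ℝ (Fin n) | ∀ i, |⟪u i, x⟫ - ⟪u i, x₀⟫| < ρ} = {x | ∀ i, |⟪u i, x - x₀⟫| < ρ} := by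
    ext x; simp only [Set.mem_setOf_eq, inner_sub_right]
  have hη : (1 - 2 * Fintype.card ι * exp (-(lam * ρ ^ 2 / 4)) / (1 / 2)) =
      1 - 4 * Fintype.card ι * exp (-(lam * ρ ^ 2 / 4)) := by ring
  rwa [hK, hη] at h

/-! ## §4 Junction: the OWNER's window END on a slab window -/

/-- **THE CONVEXITY ROAD ON A SLAB WINDOW** = `…ConvexTiltMoment.exp_moment_le_of_uniformlyConvex_window` BY NAME with
`K := {y | ∀ i, |⟪w_i, y⟫ − c_i| < ρ}` and its `hmass` binder SUPPLIED by `slabWindowMass_ge`; displayed instead: the half-space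
mass fraction `θ` at the centres (both sides, every constraint) and the smallness `hη : 2|ι|e^{−λρ²∕4}∕θ < 1`, i.e.
`ρ² > (4∕λ)·log(2|ι|∕θ)` — logarithmic in the number of constraints. [folklore] -/
theorem exp_moment_le_of_uniformlyConvex_slabWindow {ι : Type*} [Fintype ι] {V : EuclideanSpace ℝ (Fin n) → ℝ}
    {lam : ℝ} {r : ℕ} (hlam : 0 < lam) (hVc : Continuous V)
    (hV : ∀ x y : EuclideanSpace ℝ (Fin n), V x + ⟪gradient V x, y - x⟫ + lam / 2 * ‖y - x‖ ^ 2 ≤ V y)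
    (hZ : Integrable fun x => exp (-V x)) (q : Fin r → ℝ) (hq : ∀ k, 0 ≤ q k) (v : Fin r → EuclideanSpace ℝ (Fin n))
    (h1 : ∀ k, Integrable (fun x => ⟪v k, x⟫) (volume.tilted fun x => -V x))
    (h2 : ∀ k, Integrable (fun x => ⟪v k, x⟫ ^ 2) (volume.tilted fun x => -V x))
    (w : ι → EuclideanSpace ℝ (Fin n)) (hw : ∀ i, ‖w i‖ ≤ 1) (c : ι → ℝ) {ρ θ : ℝ} (hρ : 0 ≤ ρ) (hθ : 0 < θ)
    (hlo : ∀ i, θ * ∫ z, exp (-V z) ≤ ∫ x in {x | ⟪w i, x⟫ ≤ c i}, exp (-V x))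
    (hhi : ∀ i, θ * ∫ z, exp (-V z) ≤ ∫ x in {x | c i ≤ ⟪w i, x⟫}, exp (-V x))
    (hη : 2 * Fintype.card ι * exp (-(lam * ρ ^ 2 / 4)) / θ < 1) :
    ∫ x in {x | ∀ i, |⟪w i, x⟫ - c i| < ρ}, exp (-V x) ≤
      exp ((∑ k, q k * (lam⁻¹ * ‖v k‖ ^ 2 + (∫ x, ⟪v k, x⟫ ∂(volume.tilted fun x => -V x)) ^ 2)) /
          (1 - 2 * Fintype.card ι * exp (-(lam * ρ ^ 2 / 4)) / θ)) *
        ∫ x in {x | ∀ i, |⟪w i, x⟫ - c i| < ρ}, exp (-(V x + ∑ k, q k * ⟪v k, x⟫ ^ 2)) :=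
  ConvexTiltMoment.exp_moment_le_of_uniformlyConvex_window hlam hVc hV hZ q hq v h1 h2 _ hη
    (slabWindowMass_ge hlam hVc hV hZ w hw c hρ hθ hlo hhi)

end Summit.QuantumFields.BalabanUV.T4Continuum.NE7b.ConvexSlabWindowMass

end
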